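import Mathlib
import Summits.Ventures.PercRepro2.Defs
import Summits.Ventures.PercRepro2.Harris
import Summits.Ventures.PercRepro2.Graph
import Summits.Ventures.PercRepro2.Events
import Summits.Ventures.PercRepro2.BHKAvoidWeighted
import Summits.Ventures.PercRepro2.PsiPendantLemmas
import Summits.Ventures.PercRepro2.PsiUniSure
import Summits.Ventures.PercRepro2.PsiUniExplored

/-!
# The two worlds of an edge at the explored `t`-component (PercRepro2, p2)

Let `f` with `ends f = s(t', y)` be the only unpinned edge at the explored `t`-component `Λ` of `p`
(the component of `t` along the edges with `p e = 1`; `t' ∈ Λ`, `s ∉ Λ`).  On the configurations of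
positive weight (those respecting the pins of `p` off `f`) the two pins of `f` are two WORLDS of the
same product measure on the other edges (P2-G18-BERN.md §3.1):

* with `f` closed the cluster of `t` is `Λ`, so `Q = {s ↮ t}` is sure and `{t ↔ o}` is null for `o ∉ Λ`
  (`PsiUniExplored.lean`);
* with `f` open, `s ↔ t` holds exactly when `s ↔ y` holds with `f` closed (`conn_update_true_s_t_iff`),
  on `Q` the cluster of `s` is unchanged (`conn_update_true_s_iff_of_not_conn`), and the cluster of `t`
  is `Λ ∪ C(y)` (`conn_update_true_t_iff`).

`prob_update_one_eq_prob_update_zero_of_respects` transfers probabilities between the two pins along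
such correspondences; `prob_update_one_inter_compl_connEvent_eq` is the transfer of the eight
`Q`-intersected masses of the (Ψ)-slack: `P_{p[f↦1]}(A ∩ {s ↮ t}) = P_{p[f↦0]}(A' ∩ {s ↮ y})`.
-/

namespace Summit.Ventures.PercRepro2

section TEdgeGraph

variable {V : Type*} {E : Type*} [DecidableEq E] {R : Type*} [CommRing R] [LinearOrder R]

omit [DecidableEq E] in
/-- If every edge at the explored `t`-component is pinned open or closed in `ω`, everything
connected to `t` in `ω` lies in the explored component. -/
lemma conn_pinned_of_conn_or_closed {ends : E → Sym2 V} {p : E → R} {ω : Config E}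
    {t x : V}
    (hpin : ∀ e, (∃ y ∈ ends e, Conn ends (fun e => decide (p e = 1)) t y) → p e = 1 ∨ ω e = false)
    (h : Conn ends ω t x) : Conn ends (fun e => decide (p e = 1)) t x := by
  have hS : ∀ a ∈ {y | Conn ends (fun e => decide (p e = 1)) t y}, ∀ b,
      (openGraph ends ω).Adj a b → b ∈ {y | Conn ends (fun e => decide (p e = 1)) t y} := by
    intro a ha b hab
    simp only [Set.mem_setOf_eq] at ha ⊢
    obtain ⟨hne, e, he, hends⟩ := openGraph_adj.1 hab
    have hmem : a ∈ ends e := by rw [hends]; exact Sym2.mem_mk_left a b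
    rcases hpin e ⟨a, hmem, ha⟩ with hpe | hpe
    · have hadj : (openGraph ends (fun e => decide (p e = 1))).Adj a b :=
        openGraph_adj.2 ⟨hne, e, by simp [hpe], hends⟩
      exact conn_trans ha (SimpleGraph.Adj.reachable hadj)
    · rw [hpe] at he
      exact absurd he Bool.false_ne_true
  exact mem_of_conn_of_closed hS (conn_refl _ _ _) h

omit [DecidableEq E] in
/-- A configuration respecting the open pins off `f` (with `p f ≠ 1`) dominates the pinned-open
configuration. -/
lemma pinned_le_of_respects_off {p : E → R} {ω : Config E} {f : E} (hpf : p f ≠ 1)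
    (h1 : ∀ e, e ≠ f → p e = 1 → ω e = true) : (fun e => decide (p e = 1)) ≤ ω := by
  intro e
  by_cases h : p e = 1
  · have hef : e ≠ f := fun hh => hpf (hh ▸ h)
    simp [h, h1 e hef h]
  · simp [h]

omit [DecidableEq E] in
/-- The explored component is closed under the edges of a configuration respecting the closed pins
off `f` and closed at `f`: everything connected to `t` lies in it. -/
lemma conn_pinned_of_conn_off {ends : E → Sym2 V} {p : E → R} {ω : Config E} {f : E} {t x : V}
    (hpin : ∀ e, e ≠ f → (∃ v ∈ ends e, Conn ends (fun e => decide (p e = 1)) t v) →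
      p e = 0 ∨ p e = 1)
    (h0 : ∀ e, e ≠ f → p e = 0 → ω e = false) (hωf : ω f = false)
    (h : Conn ends ω t x) : Conn ends (fun e => decide (p e = 1)) t x := by
  refine conn_pinned_of_conn_or_closed (p := p) (fun e he => ?_) h
  by_cases hef : e = f
  · exact Or.inr (hef ▸ hωf)
  · rcases hpin e hef he with h0e | h1e
    · exact Or.inr (h0 e hef h0e)
    · exact Or.inl h1e

/-- **Two worlds, the connection `s ↔ t`.** With `f = (t', y)` the only unpinned edge at the explored
`t`-component (`t' ∈ Λ`, `s ∉ Λ`) and `ω` respecting the pins off `f`: `s ↔ t` with `f` open holds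
exactly when `s ↔ y` with `f` closed. -/
lemma conn_update_true_s_t_iff {ends : E → Sym2 V} {p : E → R} {ω : Config E} {f : E}
    {s t t' y : V} (hf : ends f = s(t', y))
    (ht' : Conn ends (fun e => decide (p e = 1)) t t')
    (hs : ¬ Conn ends (fun e => decide (p e = 1)) t s) (hpf : p f ≠ 1)
    (hpin : ∀ e, e ≠ f → (∃ v ∈ ends e, Conn ends (fun e => decide (p e = 1)) t v) →
      p e = 0 ∨ p e = 1)
    (h0 : ∀ e, e ≠ f → p e = 0 → ω e = false) (h1 : ∀ e, e ≠ f → p e = 1 → ω e = true) :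
    Conn ends (Function.update ω f true) s t ↔ Conn ends (Function.update ω f false) s y := by
  -- the closed-`f` world respects the pins with `f` closed; the pinned-open configuration sits below it
  have h0' : ∀ e, e ≠ f → p e = 0 → Function.update ω f false e = false := fun e he hpe => by
    rw [Function.update_of_ne he]; exact h0 e he hpe
  have hle : (fun e => decide (p e = 1)) ≤ Function.update ω f false := by
    refine pinned_le_of_respects_off hpf fun e he hpe => ?_
    rw [Function.update_of_ne he]; exact h1 e he hpe
  have hle' : Function.update ω f false ≤ Function.update ω f true := update_false_le_update_true ω f
  have hclosed : ∀ x, Conn ends (Function.update ω f false) t x →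
      Conn ends (fun e => decide (p e = 1)) t x :=
    fun x hx => conn_pinned_of_conn_off hpin h0' (by simp) hx
  -- `t ↔ t'` in the closed world
  have htt' : Conn ends (Function.update ω f false) t t' := conn_mono hle ht'
  constructor
  · intro h
    by_contra hny
    -- the closed-world cluster of `s` is closed under the open-world edges
    have hS : ∀ a ∈ {v | Conn ends (Function.update ω f false) s v}, ∀ b,
        (openGraph ends (Function.update ω f true)).Adj a b →
          b ∈ {v | Conn ends (Function.update ω f false) s v} := by
      intro a ha b hab
      simp only [Set.mem_setOf_eq] at ha ⊢
      obtain ⟨hne, e, he, hends⟩ := openGraph_adj.1 hab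
      by_cases hef : e = f
      · subst hef
        rw [hf] at hends
        rcases Sym2.eq_iff.1 hends with ⟨rfl, rfl⟩ | ⟨rfl, rfl⟩
        · -- `a = t'`: then `s ↔ t'` in the closed world, so `s ↔ t` and `s ∈ Λ`
          exact absurd (hclosed s (conn_symm (conn_trans ha (conn_symm htt')))) hs
        · exact absurd ha hny
      · rw [Function.update_of_ne hef] at he
        have hadj : (openGraph ends (Function.update ω f false)).Adj a b :=
          openGraph_adj.2 ⟨hne, e, by rw [Function.update_of_ne hef]; exact he, hends⟩
        exact conn_trans ha (SimpleGraph.Adj.reachable hadj)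
    have hst : Conn ends (Function.update ω f false) s t :=
      mem_of_conn_of_closed hS (conn_refl _ _ _) h
    exact hs (hclosed s (conn_symm hst))
  · intro h
    -- `s ↔ y`, `y ↔ t'` through the open `f`, `t' ↔ t`
    have hyt' : Conn ends (Function.update ω f true) y t' := by
      apply conn_of_openAdj
      refine ⟨f, by simp, ?_⟩
      rw [hf, Sym2.eq_swap]
    exact conn_trans (conn_mono hle' h) (conn_trans hyt' (conn_symm (conn_mono hle' htt')))

/-- **Two worlds, the cluster of `s` on `Q`.** If `s ↮ t` with `f` open, the connections of `s` are
the same in both worlds. -/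
lemma conn_update_true_s_iff_of_not_conn {ends : E → Sym2 V} {p : E → R} {ω : Config E} {f : E}
    {s t t' y : V} (hf : ends f = s(t', y))
    (ht' : Conn ends (fun e => decide (p e = 1)) t t')
    (hs : ¬ Conn ends (fun e => decide (p e = 1)) t s) (hpf : p f ≠ 1)
    (hpin : ∀ e, e ≠ f → (∃ v ∈ ends e, Conn ends (fun e => decide (p e = 1)) t v) →
      p e = 0 ∨ p e = 1)
    (h0 : ∀ e, e ≠ f → p e = 0 → ω e = false) (h1 : ∀ e, e ≠ f → p e = 1 → ω e = true)
    (hQ : ¬ Conn ends (Function.update ω f true) s t) (x : V) :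
    Conn ends (Function.update ω f true) s x ↔ Conn ends (Function.update ω f false) s x := by
  have hny : ¬ Conn ends (Function.update ω f false) s y :=
    fun hy => hQ ((conn_update_true_s_t_iff hf ht' hs hpf hpin h0 h1).2 hy)
  have h0' : ∀ e, e ≠ f → p e = 0 → Function.update ω f false e = false := fun e he hpe => by
    rw [Function.update_of_ne he]; exact h0 e he hpe
  have hle : (fun e => decide (p e = 1)) ≤ Function.update ω f false := by
    refine pinned_le_of_respects_off hpf fun e he hpe => ?_
    rw [Function.update_of_ne he]; exact h1 e he hpe
  have hclosed : ∀ x, Conn ends (Function.update ω f false) t x →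
      Conn ends (fun e => decide (p e = 1)) t x :=
    fun x hx => conn_pinned_of_conn_off hpin h0' (by simp) hx
  have htt' : Conn ends (Function.update ω f false) t t' := conn_mono hle ht'
  constructor
  · intro h
    have hS : ∀ a ∈ {v | Conn ends (Function.update ω f false) s v}, ∀ b,
        (openGraph ends (Function.update ω f true)).Adj a b →
          b ∈ {v | Conn ends (Function.update ω f false) s v} := by
      intro a ha b hab
      simp only [Set.mem_setOf_eq] at ha ⊢
      obtain ⟨hne, e, he, hends⟩ := openGraph_adj.1 hab
      by_cases hef : e = f
      · subst hef
        rw [hf] at hends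
        rcases Sym2.eq_iff.1 hends with ⟨rfl, rfl⟩ | ⟨rfl, rfl⟩
        · exact absurd (hclosed s (conn_symm (conn_trans ha (conn_symm htt')))) hs
        · exact absurd ha hny
      · rw [Function.update_of_ne hef] at he
        have hadj : (openGraph ends (Function.update ω f false)).Adj a b :=
          openGraph_adj.2 ⟨hne, e, by rw [Function.update_of_ne hef]; exact he, hends⟩
        exact conn_trans ha (SimpleGraph.Adj.reachable hadj)
    exact mem_of_conn_of_closed hS (conn_refl _ _ _) h
  · exact conn_mono (update_false_le_update_true ω f)

/-- **Two worlds, the cluster of `t`.** With `f` open, `t ↔ x` holds exactly when `x` is in the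
explored component or `y ↔ x` with `f` closed. -/
lemma conn_update_true_t_iff {ends : E → Sym2 V} {p : E → R} {ω : Config E} {f : E}
    {t t' y : V} (hf : ends f = s(t', y))
    (ht' : Conn ends (fun e => decide (p e = 1)) t t') (hpf : p f ≠ 1)
    (hpin : ∀ e, e ≠ f → (∃ v ∈ ends e, Conn ends (fun e => decide (p e = 1)) t v) →
      p e = 0 ∨ p e = 1)
    (h0 : ∀ e, e ≠ f → p e = 0 → ω e = false) (h1 : ∀ e, e ≠ f → p e = 1 → ω e = true) (x : V) :
    Conn ends (Function.update ω f true) t x ↔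
      Conn ends (fun e => decide (p e = 1)) t x ∨ Conn ends (Function.update ω f false) y x := by
  have hle : (fun e => decide (p e = 1)) ≤ Function.update ω f false := by
    refine pinned_le_of_respects_off hpf fun e he hpe => ?_
    rw [Function.update_of_ne he]; exact h1 e he hpe
  have hle' : Function.update ω f false ≤ Function.update ω f true := update_false_le_update_true ω f
  have hyt' : Conn ends (Function.update ω f true) y t' := by
    apply conn_of_openAdj
    refine ⟨f, by simp, ?_⟩
    rw [hf, Sym2.eq_swap]
  have htt' : Conn ends (Function.update ω f true) t t' := conn_mono (hle.trans hle') ht'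
  constructor
  · intro h
    -- `Λ ∪ C_closed(y)` is closed under the open-world edges
    have hS : ∀ a ∈ {v | Conn ends (fun e => decide (p e = 1)) t v ∨
        Conn ends (Function.update ω f false) y v}, ∀ b,
        (openGraph ends (Function.update ω f true)).Adj a b →
          b ∈ {v | Conn ends (fun e => decide (p e = 1)) t v ∨
            Conn ends (Function.update ω f false) y v} := by
      intro a ha b hab
      simp only [Set.mem_setOf_eq] at ha ⊢
      obtain ⟨hne, e, he, hends⟩ := openGraph_adj.1 hab
      by_cases hef : e = f
      · subst hef
        rw [hf] at hends
        rcases Sym2.eq_iff.1 hends with ⟨rfl, rfl⟩ | ⟨rfl, rfl⟩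
        · exact Or.inr (conn_refl _ _ _)
        · exact Or.inl ht'
      · rw [Function.update_of_ne hef] at he
        rcases ha with ha | ha
        · have hmem : a ∈ ends e := by rw [hends]; exact Sym2.mem_mk_left a b
          rcases hpin e hef ⟨a, hmem, ha⟩ with hpe | hpe
          · rw [h0 e hef hpe] at he
            exact absurd he Bool.false_ne_true
          · have hadj : (openGraph ends (fun e => decide (p e = 1))).Adj a b :=
              openGraph_adj.2 ⟨hne, e, by simp [hpe], hends⟩
            exact Or.inl (conn_trans ha (SimpleGraph.Adj.reachable hadj))
        · have hadj : (openGraph ends (Function.update ω f false)).Adj a b :=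
            openGraph_adj.2 ⟨hne, e, by rw [Function.update_of_ne hef]; exact he, hends⟩
          exact Or.inr (conn_trans ha (SimpleGraph.Adj.reachable hadj))
    exact mem_of_conn_of_closed hS (Or.inl (conn_refl _ _ _)) h
  · rintro (h | h)
    · exact conn_mono (hle.trans hle') h
    · exact conn_trans htt' (conn_trans (conn_symm hyt') (conn_mono hle' h))

end TEdgeGraph

section TEdgeProb

variable {E : Type*} [Fintype E] [DecidableEq E] {R : Type*} [CommRing R]

/-- The pinned-open / pinned-closed transfer, needed only on configurations respecting the pins
off `f` (the others carry no weight). -/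
lemma prob_update_one_eq_prob_update_zero_of_respects (p : E → R) (f : E) {A A' : Set (Config E)}
    (h : ∀ ω : Config E, (∀ e, e ≠ f → p e = 0 → ω e = false) →
      (∀ e, e ≠ f → p e = 1 → ω e = true) →
      (Function.update ω f true ∈ A ↔ Function.update ω f false ∈ A')) :
    prob (Function.update p f 1) A = prob (Function.update p f 0) A' := by
  rw [prob_eq_expect_indicator, prob_eq_expect_indicator, expect_update_one, expect_update_zero]
  unfold expect
  refine Finset.sum_congr rfl fun ω _ => ?_
  by_cases hr : (∀ e, e ≠ f → p e = 0 → ω e = false) ∧ (∀ e, e ≠ f → p e = 1 → ω e = true)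
  · congr 1
    by_cases hω : Function.update ω f true ∈ A
    · have h' := (h ω hr.1 hr.2).1 hω
      simp [hω, h']
    · have h' : Function.update ω f false ∉ A' := fun h' => hω ((h ω hr.1 hr.2).2 h')
      simp [hω, h']
  · -- a pin off `f` is broken: the weight vanishes
    have hw : weight p ω = 0 := by
      rw [not_and_or] at hr
      rcases hr with hr | hr
      · obtain ⟨e, he⟩ := not_forall.1 hr
        obtain ⟨_, he⟩ := Classical.not_imp.1 he
        obtain ⟨hpe, hωe⟩ := Classical.not_imp.1 he
        exact weight_eq_zero_of_breaks_pin p ω (Or.inl ⟨hpe, by simpa using hωe⟩)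
      · obtain ⟨e, he⟩ := not_forall.1 hr
        obtain ⟨_, he⟩ := Classical.not_imp.1 he
        obtain ⟨hpe, hωe⟩ := Classical.not_imp.1 he
        exact weight_eq_zero_of_breaks_pin p ω (Or.inr ⟨hpe, by simpa using hωe⟩)
    rw [hw, zero_mul, zero_mul]

end TEdgeProb

end Summit.Ventures.PercRepro2
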